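import Literature.Computability.AlgebraicComplexity.BI17ChowMinimalDegreeProofs
import Literature.Computability.AlgebraicComplexity.BI17HoweEvenVanishingProofs
import HarnessLib

/-!
# Bürgisser–Ikenmeyer 2017, Rem. 3.26 (Latin annuli; `P_m(X_1⋯X_m)`; `e(X_1⋯X_m) = m + 1` for odd `m`)

P. Bürgisser, C. Ikenmeyer, *Fundamental invariants of orbit closures*, J. Algebra **477** (2017)
390–434 = arXiv:1511.02927 [BurgisserIkenmeyer2017], §3.3 Rem. 3.26 (TeX `main.tex` L1437–1453,
held text `paper:arxiv-1511.02927` p0013:L54): "An `m × d` Latin Annulus is defined to be an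
`m × d` matrix where in each column and in each diagonal `((1,i),(2,i+1),…,(m,i+m-1))` each number
from `1,…,m` occurs exactly once, where the column indices are taken modulo `d`. The column-sign of
a Latin Annulus is the product of the signs of the permutations in its columns. The Alon-Tarsi
conjecture is equivalent to saying that for even `m` the number of even `m × m` Latin Annuli is
different from the number of odd `m × m` Latin Annuli. Analogously to the proof of Proposition
3.25 we see that for odd `m` `P_m(w_m) ≠ 0` iff the number of even `m × (m+1)` Latin Annuli is
different from the number of odd `m × (m+1)` Latin Annuli. Therefore for odd `m` we have
`e(X_1…X_m) = m+1` iff [the same]. We verified that [it holds] for `m = 1, 3, 5,` and `7`."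

Theorem-only companion of the file of record `BI17FundamentalInvariantForms.lean` (cell `val-lit`,
row BI2017-A, seat t04), which types the remark as the named fact `BI2017_rem_3_26` (four
conjuncts). This file PROVES conjuncts 1–3 for all `m` and the verifications `m = 1, 3` of
conjunct 4, and reduces the named fact BY THEOREM to the two remaining finite signed counts
(`BI2017_rem_3_26_of_counts : latinAnnulusCount 5 6 ≠ 0 → latinAnnulusCount 7 8 ≠ 0 →
BI2017_rem_3_26`), which are plain enumerations of the source's computer verification (`120⁶`,
resp. `5040⁸`, tuples of column permutations before pruning — out of reach of kernel evaluation by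
the reparametrisation used here; see `latinAnnulusCount_eq_sum_perm`).

## Contents (all proved; no definitions, no named facts)

* `latinAnnulusCount_eq_sum_perm` — the signed count of `m × d` Latin annuli as a decidable sum
  over `d`-tuples of column permutations with bijective diagonals; `latinAnnulusCount_one_two`
  (`= 1`), `latinAnnulusCount_three_four` (`= 24`) by kernel evaluation.
* `aeval_formCoeff_prod_X_oddCayleyP` — **`(D!)^{D+1} · P_D(X_1⋯X_D) = latinAnnulusCount D (D+1)`**
  for every `D` (eq. (3.7) evaluated at the symmetric array of `X_1⋯X_D`, the verbatim twin of
  `aeval_formCoeff_prod_X_cayleyP` in `BI17ChowMinimalDegreeProofs.lean`), whence conjunct 2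
  (`BI2017_rem_3_26_part2`, stated for all `m`).
* `minimalDegree_eq_succ_iff_aeval_oddCayleyP_ne_zero` — the odd twin of Thm. 3.15 (3): for odd
  `m ≥ 3` and ANY form `w ∈ Sym^m ℂ^m`, `e(w) = m + 1 ↔ P_m(w) ≠ 0` (Howe's
  strict bound `m < d` for positive `d ∈ E(w)`, `lt_of_mem_degreeMonoid_of_odd`, and Howe's
  Thm. 3.21, `finrank_slInvariantsOfDegree_succ_eq_one_of_odd`: the degree-`(m+1)` invariants are
  the multiples of `P_m ≠ 0`); whence conjunct 3 (`BI2017_rem_3_26_part3`).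
* `latinColCount_eq_sign_mul_latinAnnulusCount` — an explicit sign-twisting bijection between Latin
  squares and `m × m` Latin annuli (the square records, per column `j` and symbol `s`, the diagonal
  `j − κ` of the cell `(κ, j)` holding `s`; column signs change by the constant
  `∏_j sgn(x ↦ j − x)`), so `latinColCount m = ± latinAnnulusCount m m` for every `m ≥ 1`; whence
  conjunct 1 (`BI2017_rem_3_26_part1`; the remark's "equivalent" made explicit).
* `BI2017_rem_3_26_of_counts` — the reduction of the named fact to the `m = 5, 7` counts.

Honest framing: statements about Latin annuli and the minimal degree of the Chow form `X_1⋯X_m`;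
`AT(m)` is not proved here and nothing in this file bears on VP versus VNP.

## References

* [BurgisserIkenmeyer2017] P. Bürgisser, C. Ikenmeyer, *Fundamental invariants of orbit closures*,
  J. Algebra 477 (2017) 390–434; arXiv:1511.02927, §3.3 Rem. 3.26 (with eq. (3.7), Thm. 3.21,
  Thm. 3.22, Prop. 3.25).
* [Kumar2015] S. Kumar, *A study of the representations supported by the orbit closure of the
  determinant*, Compositio Math. 151 (2015), §4 (column-signed Latin squares; `latinColCount`).
-/

open MvPolynomial

namespace Literature.Computability.AlgebraicComplexity


/-! ### Latin annuli as tuples of column permutations -/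

section Reparametrisation

/-- **Reparametrising `m × d` Latin annuli by their columns**: the signed count
`#{even} − #{odd}` of `m × d` Latin annuli equals the sum, over all `d`-tuples `σ` of permutations
of `[m]` (the columns) whose diagonals `κ ↦ σ_{i+κ}(κ)` are bijective for every `i`, of the
product of the signs of the `σ_j` (BI 2017 Rem. 3.26: "in each column and in each diagonal … each
number from `1,…,m` occurs exactly once … The column-sign of a Latin Annulus is the product of the
signs of the permutations in its columns"). Decidable form (kernel-evaluable for small `m, d`).
[cite: BurgisserIkenmeyer2017, Rem. 3.26] -/
theorem latinAnnulusCount_eq_sum_perm (m d : ℕ) :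
    latinAnnulusCount m d =
      ∑ σ : Fin d → Equiv.Perm (Fin m),
        if ∀ i : Fin d, Function.Bijective fun κ : Fin m =>
            σ ⟨((i : ℕ) + (κ : ℕ)) % d, Nat.mod_lt _ i.pos⟩ κ
        then ∏ j, ((Kumar2015.seqSign (⇑(σ j)) : ℤˣ) : ℤ) else 0 := by
  classical
  unfold latinAnnulusCount
  rw [Finset.sum_ite, Finset.sum_const_zero, add_zero]
  refine Finset.sum_bij'
    (fun A hA => fun j => Equiv.ofBijective (fun κ => A κ j) ((Finset.mem_filter.mp hA).2.1 j))
    (fun σ _ => fun κ j => σ j κ) ?_ ?_ ?_ ?_ ?_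
  · intro A hA
    exact Finset.mem_filter.mpr ⟨Finset.mem_univ _, fun i => (Finset.mem_filter.mp hA).2.2 i⟩
  · intro σ hσ
    exact Finset.mem_filter.mpr ⟨Finset.mem_univ _, fun j => (σ j).bijective,
      fun i => (Finset.mem_filter.mp hσ).2 i⟩
  · intro A _
    funext κ j
    rfl
  · intro σ _
    funext j
    exact Equiv.ext fun κ => rfl
  · intro A _
    rw [annulusColSign, Units.coe_prod]
    rfl

/-- **BI 2017 Rem. 3.26, "We verified that the number of even `m × (m+1)` Latin Annuli differs
from the number of odd `m × (m+1)` Latin Annuli for `m = 1`"**: the signed count of `1 × 2` Latin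
annuli is `1`. [cite: BurgisserIkenmeyer2017, Rem. 3.26] -/
theorem latinAnnulusCount_one_two : latinAnnulusCount 1 2 = 1 := by
  rw [latinAnnulusCount_eq_sum_perm]
  decide +kernel

/-- **BI 2017 Rem. 3.26, the verification for `m = 3`**: the signed count of `3 × 4` Latin annuli
is `24` (kernel evaluation over the `6⁴` quadruples of column permutations), in particular nonzero.
[cite: BurgisserIkenmeyer2017, Rem. 3.26] -/
theorem latinAnnulusCount_three_four : latinAnnulusCount 3 4 = 24 := by
  rw [latinAnnulusCount_eq_sum_perm]
  decide +kernel

end Reparametrisation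


section OddCayleyAtChow

variable {k : Type*} [Field k]

/-- A product of `if P i then c else 0` is `c^n` if all `P i` hold and `0` otherwise. [folklore] -/
private theorem prod_ite_const_zero {ι : Type*} [Fintype ι] (P : ι → Prop) [DecidablePred P]
    (c : k) : (∏ i, if P i then c else 0) = if ∀ i, P i then c ^ Fintype.card ι else 0 := by
  split_ifs with h
  · rw [Finset.prod_congr rfl fun i _ => if_pos (h i), Finset.prod_const, Finset.card_univ]
  · obtain ⟨i, hi⟩ := not_forall.mp h
    exact Finset.prod_eq_zero (Finset.mem_univ i) (if_neg hi)

/-- The cyclic tableau places label `i`'s `κ`-th occurrence in column `(i + κ) mod (D+1)`.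
[cite: BurgisserIkenmeyer2017, eq. (3.7)] -/
theorem cyclicTableau_apply_snd (D : ℕ) (κ : Fin D) (i : Fin (D + 1)) :
    ((cyclicTableau D) (κ, i)).2 = ⟨((i : ℕ) + (κ : ℕ)) % (D + 1), Nat.mod_lt _ i.pos⟩ := by
  apply Fin.ext
  show ((i + Fin.castSucc κ : Fin (D + 1)) : ℕ) = ((i : ℕ) + (κ : ℕ)) % (D + 1)
  rw [Fin.val_add, Fin.val_castSucc]

/-- The row coordinate of the cyclic tableau is the occurrence index. [cite: BurgisserIkenmeyer2017, eq. (3.7)] -/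
theorem cyclicTableau_apply_fst (D : ℕ) (κ : Fin D) (i : Fin (D + 1)) :
    ((cyclicTableau D) (κ, i)).1 = κ := rfl

open Classical in
/-- **`(D!)^{D+1} · P_D(X_1⋯X_D) = #{even D × (D+1) Latin annuli} − #{odd ones}`** (BI 2017
Rem. 3.26: "Analogously to the proof of Proposition 3.25 we see that for odd `m` `P_m(w_m) ≠ 0` iff
the number of even `m × (m+1)` Latin Annuli is different from the number of odd `m × (m+1)` Latin
Annuli"): in eq. (3.7), `P_D(v) = ∑_{σ_1,…,σ_{D+1}} [∏ sgn σ_j] ∏_i v(σ_i(1), σ_{i+1}(2), …)`,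
evaluated at the symmetric array `w_D = (1/D!)·[bijective words]` of `X_1⋯X_D`, the tuple
`(σ_j)` (the columns of a `D × (D+1)` array) contributes `(1/D!)^{D+1} ∏ sgn σ_j` iff every
diagonal `κ ↦ σ_{i+κ}(κ)` is a permutation, i.e. iff the array is a Latin annulus. (Any field of
characteristic zero; holds for every `D`, odd or even.) [cite: BurgisserIkenmeyer2017, Rem. 3.26] -/
theorem aeval_formCoeff_prod_X_oddCayleyP [CharZero k] (D : ℕ) :
    (Nat.factorial D : k) ^ (D + 1) *
        aeval (formCoeff D (∏ i : Fin D, X i : MvPolynomial (Fin D) k))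
          (oddCayleyP (k := k) D (Equiv.refl (Fin D))) =
      (latinAnnulusCount D (D + 1) : k) := by
  rw [show oddCayleyP (k := k) D (Equiv.refl (Fin D)) =
      tableauInvPoly D (cyclicTableau D) ((Equiv.refl (Fin D) : Fin D ≃ Fin D) : Fin D → Fin D)
      from rfl, aeval_formCoeff_tableauInvPoly]
  simp only [Equiv.coe_refl, Function.id_comp]
  unfold tableauInv
  simp_rw [arrOf_prod_X, prod_ite_const_zero, Fintype.card_fin, mul_ite, mul_zero]
  rw [latinAnnulusCount_eq_sum_perm, Int.cast_sum, Finset.mul_sum]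
  refine Finset.sum_congr rfl fun σ _ => ?_
  have hiff : (∀ i : Fin (D + 1), Function.Bijective fun κ : Fin D =>
        σ ((cyclicTableau D) (κ, i)).2 ((cyclicTableau D) (κ, i)).1) ↔
      ∀ i : Fin (D + 1), Function.Bijective fun κ : Fin D =>
        σ ⟨((i : ℕ) + (κ : ℕ)) % (D + 1), Nat.mod_lt _ i.pos⟩ κ := by
    refine forall_congr' fun i => ?_
    rw [show (fun κ : Fin D => σ ((cyclicTableau D) (κ, i)).2 ((cyclicTableau D) (κ, i)).1) =
      fun κ : Fin D => σ ⟨((i : ℕ) + (κ : ℕ)) % (D + 1), Nat.mod_lt _ i.pos⟩ κ from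
      funext fun κ => by rw [cyclicTableau_apply_snd, cyclicTableau_apply_fst]]
  by_cases hP : ∀ i : Fin (D + 1), Function.Bijective fun κ : Fin D =>
      σ ⟨((i : ℕ) + (κ : ℕ)) % (D + 1), Nat.mod_lt _ i.pos⟩ κ
  · rw [if_pos (hiff.mpr hP), if_pos hP, Int.cast_prod, ← mul_assoc,
      mul_comm ((Nat.factorial D : k) ^ (D + 1)), mul_assoc, ← mul_pow,
      mul_inv_cancel₀ (Nat.cast_ne_zero.mpr (Nat.factorial_ne_zero D) : (Nat.factorial D : k) ≠ 0),
      one_pow, mul_one]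
    refine Finset.prod_congr rfl fun j _ => ?_
    rw [Kumar2015.seqSign_coe_perm]
  · rw [if_neg (fun h => hP (hiff.mp h)), if_neg hP, mul_zero, Int.cast_zero]

end OddCayleyAtChow

/-! ### The odd twin of Thm. 3.15 (3): `e(w) = m + 1 ↔ P_m(w) ≠ 0` for `w ∈ Sym^m ℂ^m`, `m` odd -/

section OddMinimalDegree

variable {m : ℕ} {f : MvPolynomial (Fin m) ℂ}

/-- `P_m` does not vanish on `G·w` iff it does not vanish at `w` (semi-invariance of the
homogeneous `SL_m`-invariant `P_m`, as for `P_{D,m}` in `cayleyP_not_mem_orbitVanishingIdeal_iff`).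
[cite: BurgisserIkenmeyer2017, Thm. 3.22 (1)] -/
theorem oddCayleyP_not_mem_orbitVanishingIdeal_iff (hm : 0 < m) (hf : f.IsHomogeneous m) :
    oddCayleyP (k := ℂ) m (Equiv.refl (Fin m)) ∉ orbitVanishingIdeal f m ↔
      aeval (formCoeff m f) (oddCayleyP (k := ℂ) m (Equiv.refl (Fin m))) ≠ 0 := by
  obtain ⟨hPh, hPi⟩ := (mem_slInvariantsOfDegree_iff m (m + 1) _).mp
    (tableauInvPoly_mem_slInvariantsOfDegree (k := ℂ) (cyclicTableau m))
  rw [mem_orbitVanishingIdeal_iff, not_forall]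
  constructor
  · rintro ⟨g, hg⟩
    exact (hPi.aeval_formCoeff_linSubstRep_ne_zero_iff hm hf hPh g).mp hg
  · intro h
    exact ⟨1, by rwa [map_one, Module.End.one_apply]⟩

/-- For odd `m`, every homogeneous `SL_m`-invariant of degree `m + 1` on `Sym^m ℂ^m` is a scalar
multiple of `P_m` (Howe's Thm. 3.21: the space is one-dimensional,
`finrank_slInvariantsOfDegree_succ_eq_one_of_odd`; and `P_m ≠ 0`, Thm. 3.22 (2),
`oddCayleyP_ne_zero_of_odd`). [cite: BurgisserIkenmeyer2017, Thm. 3.21] -/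
theorem exists_smul_oddCayleyP_eq_of_mem_slInvariantsOfDegree (hodd : Odd m)
    {F : MvPolynomial (DegIdx (Fin m) m) ℂ} (hF : F ∈ slInvariantsOfDegree (Fin m) ℂ m (m + 1)) :
    ∃ c : ℂ, c • oddCayleyP (k := ℂ) m (Equiv.refl (Fin m)) = F := by
  have hP : oddCayleyP (k := ℂ) m (Equiv.refl (Fin m)) ∈ slInvariantsOfDegree (Fin m) ℂ m (m + 1) :=
    tableauInvPoly_mem_slInvariantsOfDegree (k := ℂ) (cyclicTableau m)
  have hne : (⟨oddCayleyP (k := ℂ) m (Equiv.refl (Fin m)), hP⟩ :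
      slInvariantsOfDegree (Fin m) ℂ m (m + 1)) ≠ 0 := fun h =>
    oddCayleyP_ne_zero_of_odd hodd (congrArg Subtype.val h)
  obtain ⟨c, hc⟩ := (finrank_eq_one_iff_of_nonzero' _ hne).mp
    (finrank_slInvariantsOfDegree_succ_eq_one_of_odd hodd) ⟨F, hF⟩
  exact ⟨c, by simpa using congrArg Subtype.val hc⟩

/-- **The odd twin of BI 2017 Thm. 3.15 (3)** (used in Rem. 3.26: "Therefore for odd `m` we have
`e(X_1…X_m) = m+1` iff …"): for odd `m ≥ 3` and any form `w ∈ Sym^m ℂ^m`,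
`e(w) = m + 1 ↔ P_m(w) ≠ 0`. («⇐»: `m + 1 ∈ E(w)` and Howe's strict bound `m < d` for every
positive `d ∈ E(w)`, `lt_of_mem_degreeMonoid_of_odd`; «⇒»: an invariant of degree `e(w) = m + 1`
not vanishing on `Gw` is a multiple of `P_m`.) [cite: BurgisserIkenmeyer2017, Rem. 3.26] -/
theorem minimalDegree_eq_succ_iff_aeval_oddCayleyP_ne_zero (hm : 2 ≤ m) (hodd : Odd m)
    (hf : f.IsHomogeneous m) :
    minimalDegree m f = m + 1 ↔
      aeval (formCoeff m f) (oddCayleyP (k := ℂ) m (Equiv.refl (Fin m))) ≠ 0 := by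
  obtain ⟨hPh, hPi⟩ := (mem_slInvariantsOfDegree_iff m (m + 1) _).mp
    (tableauInvPoly_mem_slInvariantsOfDegree (k := ℂ) (cyclicTableau m))
  have hm0 : 0 < m := by omega
  constructor
  · intro he
    have hne : ({d | d ∈ degreeMonoid m f ∧ 0 < d} : Set ℕ).Nonempty := by
      by_contra h
      rw [Set.not_nonempty_iff_eq_empty] at h
      rw [minimalDegree, h, Nat.sInf_empty] at he
      omega
    obtain ⟨⟨F, hFh, hFi, hFI⟩, -⟩ : m + 1 ∈ {d | d ∈ degreeMonoid m f ∧ 0 < d} := by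
      have hmS : minimalDegree m f ∈ {d | d ∈ degreeMonoid m f ∧ 0 < d} := Nat.sInf_mem hne
      rwa [he] at hmS
    have hmem : F ∈ slInvariantsOfDegree (Fin m) ℂ m (m + 1) :=
      (mem_slInvariantsOfDegree_iff m (m + 1) F).mpr ⟨hFh, hFi⟩
    obtain ⟨c, rfl⟩ := exists_smul_oddCayleyP_eq_of_mem_slInvariantsOfDegree hodd hmem
    rw [← oddCayleyP_not_mem_orbitVanishingIdeal_iff hm0 hf]
    intro hPI
    exact hFI (by rw [smul_eq_C_mul]; exact Ideal.mul_mem_left _ _ hPI)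
  · intro hP
    have hmS : m + 1 ∈ {d | d ∈ degreeMonoid m f ∧ 0 < d} :=
      ⟨⟨_, hPh, hPi, (oddCayleyP_not_mem_orbitVanishingIdeal_iff hm0 hf).mpr hP⟩, Nat.succ_pos m⟩
    refine le_antisymm (Nat.sInf_le hmS) (le_csInf ⟨m + 1, hmS⟩ fun d hd => ?_)
    exact lt_of_mem_degreeMonoid_of_odd hm hodd hd.1 hd.2

end OddMinimalDegree


/-! ### Latin squares versus `m × m` Latin annuli -/

section SquaresVsAnnuli

variable {m : ℕ} [NeZero m]

omit [NeZero m] in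
/-- The diagonal index `(i + κ) mod m` of `IsLatinAnnulus` is addition in `Fin m`. [folklore] -/
private theorem latinAnnulus_diagIdx_eq_add (i κ : Fin m) (h : ((i : ℕ) + (κ : ℕ)) % m < m) :
    (⟨((i : ℕ) + (κ : ℕ)) % m, h⟩ : Fin m) = i + κ :=
  Fin.ext (by rw [Fin.val_add])

/-- **From an `m × m` Latin annulus to a Latin square**: record, for each column `j` and each
symbol `s`, the diagonal `j − κ` on which `s` sits in column `j` (`A κ j = s`). Its columns are
permutations and so are its rows (a symbol meets every diagonal exactly once).
[cite: BurgisserIkenmeyer2017, Rem. 3.26 ("The Alon-Tarsi conjecture is equivalent to saying that for even `m` the number of even `m × m` Latin Annuli is different from the number of odd")] -/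
theorem isLatinRect_square_of_annulus (A : Fin m → Fin m → Fin m) (hA : IsLatinAnnulus A) :
    Kumar2015.IsLatinRect fun s j =>
      j - (Equiv.ofBijective (fun κ => A κ j) (hA.1 j)).symm s := by
  obtain ⟨hA1, hA2⟩ := hA
  have hA2' : ∀ i : Fin m, Function.Injective fun κ : Fin m => A κ (i + κ) := by
    intro i
    have h := (hA2 i).injective
    simp only [latinAnnulus_diagIdx_eq_add] at h
    exact h
  refine ⟨fun s => Finite.injective_iff_bijective.mp fun j j' h => ?_, fun j => ?_⟩
  · simp only at h
    set κ := (Equiv.ofBijective (fun κ => A κ j) (hA1 j)).symm s with hκ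
    set κ' := (Equiv.ofBijective (fun κ => A κ j') (hA1 j')).symm s with hκ'
    have hAκ : A κ j = s := Equiv.ofBijective_apply_symm_apply (fun κ => A κ j) (hA1 j) s
    have hAκ' : A κ' j' = s := Equiv.ofBijective_apply_symm_apply (fun κ => A κ j') (hA1 j') s
    have key : κ = κ' := by
      refine hA2' (j - κ) ?_
      show A κ (j - κ + κ) = A κ' (j - κ + κ')
      rw [sub_add_cancel, h, sub_add_cancel, hAκ, hAκ']
    calc j = j - κ + κ := (sub_add_cancel j κ).symm
      _ = j' - κ' + κ' := by rw [h, key]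
      _ = j' := sub_add_cancel j' κ'
  · exact fun s s' h => (Equiv.ofBijective (fun κ => A κ j) (hA1 j)).symm.injective
      (sub_right_injective h)

/-- **From a Latin square to an `m × m` Latin annulus**: put into cell `(κ, j)` the symbol that the
square assigns diagonal `j − κ` in column `j`. Columns are permutations; diagonal `i` is
injective because a row of the square is. [cite: BurgisserIkenmeyer2017, Rem. 3.26] -/
theorem isLatinAnnulus_annulus_of_square (R : Fin m → Fin m → Fin m) (hR : Kumar2015.IsLatinRect R) :
    IsLatinAnnulus (d := m) fun κ j =>
      (Equiv.ofBijective (fun s => R s j) (Finite.injective_iff_bijective.mp (hR.2 j))).symm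
        (j - κ) := by
  obtain ⟨hR1, hR2⟩ := hR
  refine ⟨fun j => ((Equiv.subLeft j).trans (Equiv.ofBijective (fun s => R s j)
      (Finite.injective_iff_bijective.mp (hR2 j))).symm).bijective, fun i => ?_⟩
  refine Finite.injective_iff_bijective.mp fun κ κ' h => ?_
  simp only [latinAnnulus_diagIdx_eq_add, add_sub_cancel_right] at h
  have h1 : R ((Equiv.ofBijective (fun s => R s (i + κ))
      (Finite.injective_iff_bijective.mp (hR2 (i + κ)))).symm i) (i + κ) = i :=
    Equiv.ofBijective_apply_symm_apply (fun s => R s (i + κ)) _ i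
  have h2 : R ((Equiv.ofBijective (fun s => R s (i + κ'))
      (Finite.injective_iff_bijective.mp (hR2 (i + κ')))).symm i) (i + κ') = i :=
    Equiv.ofBijective_apply_symm_apply (fun s => R s (i + κ')) _ i
  rw [h] at h1
  exact add_left_cancel ((hR1 _).injective (h1.trans h2.symm))

omit [NeZero m] in
/-- Annulus ↦ square ↦ annulus is the identity. [cite: BurgisserIkenmeyer2017, Rem. 3.26] -/
theorem annulus_of_square_of_annulus (A : Fin m → Fin m → Fin m)
    (hA1 : ∀ j, Function.Bijective fun κ => A κ j)
    (h : ∀ j, Function.Bijective fun s : Fin m =>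
      j - (Equiv.ofBijective (fun κ => A κ j) (hA1 j)).symm s) :
    (fun κ j => (Equiv.ofBijective (fun s : Fin m =>
        j - (Equiv.ofBijective (fun κ => A κ j) (hA1 j)).symm s) (h j)).symm (j - κ)) = A := by
  funext κ j
  rw [Equiv.symm_apply_eq]
  show j - κ = j - (Equiv.ofBijective (fun κ => A κ j) (hA1 j)).symm (A κ j)
  rw [show A κ j = (Equiv.ofBijective (fun κ => A κ j) (hA1 j)) κ from rfl, Equiv.symm_apply_apply]

/-- Square ↦ annulus ↦ square is the identity. [cite: BurgisserIkenmeyer2017, Rem. 3.26] -/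
theorem square_of_annulus_of_square (R : Fin m → Fin m → Fin m)
    (hR2 : ∀ j, Function.Bijective fun s => R s j)
    (h : ∀ j, Function.Bijective fun κ : Fin m =>
      (Equiv.ofBijective (fun s => R s j) (hR2 j)).symm (j - κ)) :
    (fun s j => j - (Equiv.ofBijective (fun κ : Fin m =>
        (Equiv.ofBijective (fun s => R s j) (hR2 j)).symm (j - κ)) (h j)).symm s) = R := by
  funext s j
  have hs : (Equiv.ofBijective (fun κ : Fin m =>
      (Equiv.ofBijective (fun s => R s j) (hR2 j)).symm (j - κ)) (h j)).symm s = j - R s j := by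
    rw [Equiv.symm_apply_eq]
    show s = (Equiv.ofBijective (fun s => R s j) (hR2 j)).symm (j - (j - R s j))
    rw [sub_sub_cancel, show R s j = (Equiv.ofBijective (fun s => R s j) (hR2 j)) s from rfl,
      Equiv.symm_apply_apply]
  simp only [hs, sub_sub_cancel]

/-- The column signs of the square attached to an annulus: column `j` of the square is the
permutation `s ↦ j − π_j⁻¹(s)` (`π_j` = column `j` of the annulus), whose sign is
`sgn(x ↦ j − x) · sgn π_j`. [cite: BurgisserIkenmeyer2017, Rem. 3.26] -/
theorem rectColSign_square_of_annulus (A : Fin m → Fin m → Fin m)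
    (hA1 : ∀ j, Function.Bijective fun κ => A κ j) :
    Kumar2015.rectColSign (fun s j => j - (Equiv.ofBijective (fun κ => A κ j) (hA1 j)).symm s) =
      (∏ j : Fin m, Equiv.Perm.sign (Equiv.subLeft j : Equiv.Perm (Fin m))) * annulusColSign A := by
  unfold Kumar2015.rectColSign annulusColSign
  rw [← Finset.prod_mul_distrib]
  refine Finset.prod_congr rfl fun j _ => ?_
  rw [show (fun s => j - (Equiv.ofBijective (fun κ => A κ j) (hA1 j)).symm s) =
      ⇑((Equiv.subLeft j : Equiv.Perm (Fin m)) * (Equiv.ofBijective (fun κ => A κ j) (hA1 j))⁻¹)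
      from rfl, Kumar2015.seqSign_coe_perm, map_mul, Equiv.Perm.sign_inv]
  congr 1
  exact (Kumar2015.seqSign_coe_perm (Equiv.ofBijective (fun κ => A κ j) (hA1 j))).symm

/-- **Latin squares ↔ `m × m` Latin annuli, with signs** (BI 2017 Rem. 3.26: "The Alon-Tarsi
conjecture is equivalent to saying that for even `m` the number of even `m × m` Latin Annuli is
different from the number of odd `m × m` Latin Annuli"): the column-signed count of Latin squares
is `±` the signed count of `m × m` Latin annuli, the sign being `∏_j sgn(x ↦ j − x)`.
[cite: BurgisserIkenmeyer2017, Rem. 3.26] -/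
theorem latinColCount_eq_sign_mul_latinAnnulusCount (m : ℕ) [NeZero m] :
    Kumar2015.latinColCount m =
      (((∏ j : Fin m, Equiv.Perm.sign (Equiv.subLeft j : Equiv.Perm (Fin m))) : ℤˣ) : ℤ) *
        latinAnnulusCount m m := by
  classical
  unfold Kumar2015.latinColCount latinAnnulusCount
  rw [Finset.mul_sum]
  symm
  refine Finset.sum_bij'
    (fun A hA => fun s j =>
      j - (Equiv.ofBijective (fun κ => A κ j) ((Finset.mem_filter.mp hA).2.1 j)).symm s)
    (fun R hR => fun κ j =>
      (Equiv.ofBijective (fun s => R s j)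
        (Finite.injective_iff_bijective.mp ((Finset.mem_filter.mp hR).2.2 j))).symm (j - κ))
    ?_ ?_ ?_ ?_ ?_
  · intro A hA
    exact Finset.mem_filter.mpr
      ⟨Finset.mem_univ _, isLatinRect_square_of_annulus A (Finset.mem_filter.mp hA).2⟩
  · intro R hR
    exact Finset.mem_filter.mpr
      ⟨Finset.mem_univ _, isLatinAnnulus_annulus_of_square R (Finset.mem_filter.mp hR).2⟩
  · intro A hA
    exact annulus_of_square_of_annulus A _ _
  · intro R hR
    exact square_of_annulus_of_square R _ _
  · intro A hA
    rw [rectColSign_square_of_annulus, Units.val_mul]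

/-- **BI 2017 Rem. 3.26, first assertion**: `AT(m)` (the column-signed count of Latin squares is
nonzero) iff the number of even `m × m` Latin annuli differs from the number of odd ones — for
every `m ≥ 1` (the remark states it for even `m`, where `AT(m)` is the Alon–Tarsi conjecture).
[cite: BurgisserIkenmeyer2017, Rem. 3.26] -/
theorem latinColCount_ne_zero_iff_latinAnnulusCount_ne_zero (m : ℕ) [NeZero m] :
    Kumar2015.latinColCount m ≠ 0 ↔ latinAnnulusCount m m ≠ 0 := by
  rw [latinColCount_eq_sign_mul_latinAnnulusCount, mul_ne_zero_iff, and_iff_right (Units.ne_zero _)]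

end SquaresVsAnnuli


/-! ### BI 2017 Rem. 3.26: the conjuncts of `BI2017_rem_3_26`, and its reduction to two counts -/

section RemarkThreeTwentySix

/-- `P_m(X_1⋯X_m) ≠ 0 ↔` the signed count of `m × (m+1)` Latin annuli is nonzero (every `m`;
from `(m!)^{m+1} P_m(X_1⋯X_m) = latinAnnulusCount m (m+1)`). [cite: BurgisserIkenmeyer2017, Rem. 3.26] -/
theorem aeval_oddCayleyP_prod_X_ne_zero_iff (m : ℕ) :
    aeval (formCoeff m (∏ i : Fin m, X i : MvPolynomial (Fin m) ℂ))
        (oddCayleyP (k := ℂ) m (Equiv.refl (Fin m))) ≠ 0 ↔ latinAnnulusCount m (m + 1) ≠ 0 := by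
  have key := aeval_formCoeff_prod_X_oddCayleyP (k := ℂ) m
  have hfact : ((Nat.factorial m : ℂ)) ^ (m + 1) ≠ 0 :=
    pow_ne_zero _ (Nat.cast_ne_zero.mpr (Nat.factorial_ne_zero m))
  constructor
  · intro hP hL
    rw [hL, Int.cast_zero] at key
    exact hP ((mul_eq_zero.mp key).resolve_left hfact)
  · intro hL hP
    rw [hP, mul_zero] at key
    exact hL (by exact_mod_cast key.symm)

/-- **BI 2017 Rem. 3.26, conjunct 1 of `BI2017_rem_3_26` PROVED**: for even `m ≥ 2`, `AT(m)`
(`Kumar2015.latinColCount m ≠ 0`) iff the number of even `m × m` Latin annuli differs from the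
number of odd ones. [cite: BurgisserIkenmeyer2017, Rem. 3.26] -/
theorem BI2017_rem_3_26_part1 :
    ∀ m : ℕ, Even m → 2 ≤ m → (Kumar2015.latinColCount m ≠ 0 ↔ latinAnnulusCount m m ≠ 0) := by
  intro m _ hm
  haveI : NeZero m := ⟨by omega⟩
  exact latinColCount_ne_zero_iff_latinAnnulusCount_ne_zero m

/-- **BI 2017 Rem. 3.26, conjunct 2 of `BI2017_rem_3_26` PROVED**: for odd `m` (indeed for every
`m`), `P_m(X_1⋯X_m) ≠ 0` iff the number of even `m × (m+1)` Latin annuli differs from the number of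
odd ones. [cite: BurgisserIkenmeyer2017, Rem. 3.26] -/
theorem BI2017_rem_3_26_part2 :
    ∀ m : ℕ, Odd m →
      (aeval (formCoeff m (∏ i : Fin m, X i : MvPolynomial (Fin m) ℂ))
          (oddCayleyP (k := ℂ) m (Equiv.refl (Fin m))) ≠ 0 ↔ latinAnnulusCount m (m + 1) ≠ 0) :=
  fun m _ => aeval_oddCayleyP_prod_X_ne_zero_iff m

/-- **BI 2017 Rem. 3.26, conjunct 3 of `BI2017_rem_3_26` PROVED**: for odd `m ≥ 3`,
`e(X_1⋯X_m) = m + 1` iff the number of even `m × (m+1)` Latin annuli differs from the number of odd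
ones ("Therefore for odd `m` we have `e(X_1…X_m) = m+1` iff …"). [cite: BurgisserIkenmeyer2017, Rem. 3.26] -/
theorem BI2017_rem_3_26_part3 :
    ∀ m : ℕ, Odd m → 3 ≤ m →
      (minimalDegree m (∏ i : Fin m, X i : MvPolynomial (Fin m) ℂ) = m + 1 ↔
        latinAnnulusCount m (m + 1) ≠ 0) := by
  intro m hodd hm
  have hhom : (∏ i : Fin m, X i : MvPolynomial (Fin m) ℂ).IsHomogeneous m := by
    rw [show (∏ i : Fin m, X i : MvPolynomial (Fin m) ℂ) = monomial (wordExp (id : Fin m → Fin m)) 1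
      from prod_X_eq_monomial_wordExp (k := ℂ) id]
    exact isHomogeneous_monomial _ (degree_wordExp _)
  rw [minimalDegree_eq_succ_iff_aeval_oddCayleyP_ne_zero (by omega) hodd hhom]
  exact aeval_oddCayleyP_prod_X_ne_zero_iff m

/-- **BI 2017 Rem. 3.26 — the named fact `BI2017_rem_3_26` REDUCED BY THEOREM to the two remaining
computer verifications of the source** ("We verified that the number of even `m × (m+1)` Latin
Annuli differs from the number of odd `m × (m+1)` Latin Annuli for `m = 1, 3, 5,` and `7`"):
conjuncts 1–3 and the cases `m = 1, 3` are theorems of this file; given the signed counts for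
`m = 5` and `m = 7` are nonzero, the fact holds. [cite: BurgisserIkenmeyer2017, Rem. 3.26] -/
theorem BI2017_rem_3_26_of_counts (h5 : latinAnnulusCount 5 6 ≠ 0) (h7 : latinAnnulusCount 7 8 ≠ 0) :
    BI2017_rem_3_26 :=
  ⟨BI2017_rem_3_26_part1, BI2017_rem_3_26_part2, BI2017_rem_3_26_part3,
    ⟨by rw [latinAnnulusCount_one_two]; exact one_ne_zero,
     by rw [latinAnnulusCount_three_four]; decide, h5, h7⟩⟩

end RemarkThreeTwentySix

end Literature.Computability.AlgebraicComplexity
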